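import Summits.QuantumFields.YangMills.Theses.FlatTubeReduction
import Summits.QuantumFields.YangMills.Theorems.FemtoCutoffLadderUpStepEvGlueEx
import Summits.QuantumFields.YangMills.Theorems.FemtoCutoffLadderWindowMatching
import Summits.QuantumFields.YangMills.Theorems.FemtoTransferGapPositivity

/-!
# Route `FlatTubeReduction` (items shared with `FemtoCutoffLadder`): LINE g6-A «unit-slab ladder» — GLUE
(planner ym-idea-1 g6, 2026-08-28; bears on the shared crux `UpStepEv` stmt-QuantumFields-26796; rung R2b1 = RECORD-label femto gap —
nothing here concerns infinite volume, the continuum limit or the Clay Yang–Mills mass gap; no summit statement is proved)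

New items (route file `Theses/FlatTubeReduction.lean`, filed by `ledger workitem add`):

* `UnitUpStep`       — the incommensurable variational up-step RESTRICTED to the unit pair `(L', L'+1)` with the proportional budget
                        `exp(C·Λ²/L')`; TIGHTENED back to `UpStepEv` by telescoping ≤ L'−1 unit steps (Σ 1/L'' < 1).
* `PinnedUnitStepEx` — the ENGINE: the body of `PinnedUpStepEx` (27379) at `L = L'+1` (one doubled coordinate slab per axis) with
                        budget `exp(C·Λ²/L')`.
Theorems (sorry-free, no definitions):
* `UnitLadder.telescope` — the telescoping core (induction on the fine size `n` from `L'` with `Nat.le_induction`; intermediate matched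
  couplings from `matchedCouplingExists_proof`, uniqueness at a size by `WindowMatching.beta_eq_of_window`; cancellation of the positive
  `topValue` powers (`topValue_su2Rep_pos`); budget `Σ_{L''=L'}^{n-1} 1/L'' ≤ (n − L')/L'`);
* ★ `UnitLadder.upStepEv_of_unitUpStep : UnitUpStep → UpStepEv` (items 27556 → 26796; constant `max C 0`, `lam0 ∧ 1/2`; inside the
  octave `(L − L')/L' < 1`);
* ★★ `UnitLadder.unitUpStep_of_pinnedUnitStepEx : PinnedUnitStepEx → UnitUpStep` (items 27561 → 27556) — the min–max door of
  `upStepEv_of_pinnedUpStepEx` (p624204) run at the unit pair with `s = C·Λ²/L'` (`PhysL2.exists_groundState`, `Dirichlet.ratio_multiplier`,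
  `Thinning.isPhys_avg_thin_shift`, `thin_eq_pinnedInline`, `torusConfigShift_eq_pinnedInline`, `IsPhys.mul_of_invariant`,
  `UpStep.recentred_moments`, `UpStep.l2_iterate_le_pow_secondValue`);
* `UnitLadder.upStepEv_of_pinnedUnitStepEx`, `UnitLadder.fcl_upStepEv_of_unitUpStep` (the `FemtoCutoffLadder` copy of the shared crux has the
  same body).
HONEST FRAMING: glue only; the analytic content (the one-slab pinned autocorrelation comparison, XL) is OPEN in item 27561.
References: M. Lüscher, NPB 219 (1983) 233 [cite: Luscher1983, §3]; M. Lüscher, P. Weisz, U. Wolff, NPB 359 (1991) 221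
[cite: LuscherWeiszWolff1991, §2]; T. Balaban, CMP 98 (1985) 17 [cite: Balaban1985Averaging, §1].
-/

set_option autoImplicit false

open MeasureTheory
open Literature.MathematicalPhysics.QuantumFieldTheory (Site Edge GaugeConfig torusConfigShift torusConfigShift_apply)
open Literature.MathematicalPhysics.QuantumLattice


namespace Summit.QuantumFields.YangMills.Theorems.FlatTubeReduction.UnitLadder

open Summit.QuantumFields.YangMills.Theorems.FemtoTransferGap
open Summit.QuantumFields.YangMills.Theses.FlatTubeReduction
open Summit.QuantumFields.YangMills.Theorems.FemtoCutoffLadder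

/-- Telescoping core: from the unit steps (with a NON-NEGATIVE constant) at every size `≥ L0`, the comparison of the lattice `L'` with any
larger window lattice `n` at matched label, with budget `C·Λ'²·(n − L')/L'`. [cite: LuscherWeiszWolff1991, §2] -/
theorem telescope {C lam : ℝ} (hC : 0 ≤ C) (hlam : 0 < lam) (hlam2 : lam ≤ 1 / 2) {L0 : ℕ}
    (HL : ∀ (L' : ℕ) [NeZero L'], L0 ≤ L' → ∀ β β' : ℝ, InFemtoWindow lam β (L' + 1) → InFemtoWindow lam β' L' →
      luscherLambda β (L' + 1) = luscherLambda β' L' →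
      secondValue su2Rep L' β' ^ L' * topValue su2Rep (L' + 1) β ^ (L' + 1) ≤
        Real.exp (C * luscherLambda β (L' + 1) ^ 2 / (L' : ℝ)) * (secondValue su2Rep (L' + 1) β ^ (L' + 1) * topValue su2Rep L' β' ^ L'))
    (L' : ℕ) [NeZero L'] (hL0 : L0 ≤ L') (β' : ℝ) (hW' : InFemtoWindow lam β' L') :
    ∀ n : ℕ, L' ≤ n → ∀ [NeZero n], ∀ βn : ℝ, InFemtoWindow lam βn n → luscherLambda βn n = luscherLambda β' L' →
      secondValue su2Rep L' β' ^ L' * topValue su2Rep n βn ^ n ≤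
        Real.exp (C * luscherLambda β' L' ^ 2 * ((n : ℝ) - L') / (L' : ℝ)) * (secondValue su2Rep n βn ^ n * topValue su2Rep L' β' ^ L') := by
  intro n hn
  induction n, hn using Nat.le_induction with
  | base =>
    intro _ βn hWn hmn
    have hb : βn = β' := WindowMatching.beta_eq_of_window hlam hWn hW' hmn
    subst hb
    simp
  | succ n hLn ih =>
    intro _ βn hWn hmn
    haveI : NeZero n := ⟨by have := NeZero.ne L'; omega⟩
    -- matched coupling at the intermediate size `n`
    obtain ⟨βm, hWm, hmm⟩ := matchedCouplingExists_proof lam hlam hlam2 (n + 1) n βn hWn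
    have hmm' : luscherLambda βm n = luscherLambda β' L' := hmm.trans hmn
    have hIH := ih βm hWm hmm'
    have hL0n : L0 ≤ n := hL0.trans hLn
    have hunit := HL n hL0n βn βm hWn hWm hmm.symm
    -- positivity
    have htn : 0 < topValue su2Rep n βm ^ n := pow_pos (topValue_su2Rep_pos n βm) _
    have ht1 : 0 ≤ topValue su2Rep (n + 1) βn ^ (n + 1) := pow_nonneg (topValue_su2Rep_pos (n + 1) βn).le _
    have ht' : 0 ≤ topValue su2Rep L' β' ^ L' := pow_nonneg (topValue_su2Rep_pos L' β').le _
    set s' := secondValue su2Rep L' β' ^ L' with hs'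
    set t' := topValue su2Rep L' β' ^ L' with ht'd
    set sn := secondValue su2Rep n βm ^ n
    set tn := topValue su2Rep n βm ^ n
    set s1 := secondValue su2Rep (n + 1) βn ^ (n + 1)
    set t1 := topValue su2Rep (n + 1) βn ^ (n + 1)
    set E1 := Real.exp (C * luscherLambda β' L' ^ 2 * ((n : ℝ) - L') / (L' : ℝ)) with hE1
    set E2 := Real.exp (C * luscherLambda βn (n + 1) ^ 2 / (n : ℝ)) with hE2
    have hE1pos : 0 < E1 := Real.exp_pos _
    have hE2pos : 0 < E2 := Real.exp_pos _
    -- chain: s' t1 tn ≤ E1 t' (sn t1) ≤ E1 t' E2 s1 tn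
    have h1 : s' * t1 * tn ≤ E1 * t' * (sn * t1) := by
      have := mul_le_mul_of_nonneg_right hIH ht1
      calc s' * t1 * tn = s' * tn * t1 := by ring
        _ ≤ E1 * (sn * t') * t1 := this
        _ = E1 * t' * (sn * t1) := by ring
    have h2 : E1 * t' * (sn * t1) ≤ E1 * t' * (E2 * (s1 * tn)) :=
      mul_le_mul_of_nonneg_left hunit (mul_nonneg hE1pos.le ht')
    have h3 : s' * t1 * tn ≤ (E1 * E2 * (s1 * t')) * tn := by
      calc s' * t1 * tn ≤ E1 * t' * (E2 * (s1 * tn)) := h1.trans h2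
        _ = (E1 * E2 * (s1 * t')) * tn := by ring
    have h4 : s' * t1 ≤ E1 * E2 * (s1 * t') := le_of_mul_le_mul_right h3 htn
    -- budget: E1 * E2 ≤ exp (C Λ'^2 ((n+1) - L') / L')
    have hΛ : luscherLambda βn (n + 1) = luscherLambda β' L' := hmn
    have hL'pos : (0 : ℝ) < L' := by exact_mod_cast Nat.pos_of_ne_zero (NeZero.ne L')
    have hnpos : (0 : ℝ) < n := by exact_mod_cast Nat.pos_of_ne_zero (NeZero.ne n)
    have hL'n : (L' : ℝ) ≤ n := by exact_mod_cast hLn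
    have hb : C * luscherLambda βn (n + 1) ^ 2 / (n : ℝ) ≤ C * luscherLambda β' L' ^ 2 / (L' : ℝ) := by
      rw [hΛ]
      exact div_le_div_of_nonneg_left (by positivity) hL'pos hL'n
    have hE : E1 * E2 ≤ Real.exp (C * luscherLambda β' L' ^ 2 * (((n + 1 : ℕ) : ℝ) - L') / (L' : ℝ)) := by
      rw [hE1, hE2, ← Real.exp_add]
      apply Real.exp_le_exp.mpr
      have : C * luscherLambda β' L' ^ 2 * (((n + 1 : ℕ) : ℝ) - L') / (L' : ℝ)
          = C * luscherLambda β' L' ^ 2 * ((n : ℝ) - L') / (L' : ℝ) + C * luscherLambda β' L' ^ 2 / (L' : ℝ) := by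
        push_cast; ring
      rw [this]
      linarith
    have hs1t' : 0 ≤ s1 * t' := mul_nonneg (pow_nonneg (secondValue_su2Rep_nonneg (n + 1) (zero_le_one.trans hWn.1)) _) ht'
    exact h4.trans (mul_le_mul_of_nonneg_right hE hs1t')

/-- ★ **`UnitUpStep → UpStepEv`** (items 27556 → 26796): telescoping ≤ L'−1 unit steps inside the octave, `Σ 1/L'' ≤ (L−L')/L' < 1`.
[cite: LuscherWeiszWolff1991, §2] [cite: Luscher1983, §3] -/
theorem upStepEv_of_unitUpStep (h : UnitUpStep) : UpStepEv := by
  obtain ⟨C, lam0, hlam0, H⟩ := h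
  refine ⟨max C 0, min lam0 (1 / 2), lt_min hlam0 (by norm_num), fun lam hlam hle => ?_⟩
  have hle0 : lam ≤ lam0 := hle.trans (min_le_left _ _)
  have hle2 : lam ≤ 1 / 2 := hle.trans (min_le_right _ _)
  obtain ⟨L0, HL⟩ := H lam hlam hle0
  have hC : 0 ≤ max C 0 := le_max_right _ _
  -- the unit steps with the non-negative constant
  have HL' : ∀ (L' : ℕ) [NeZero L'], L0 ≤ L' → ∀ β β' : ℝ, InFemtoWindow lam β (L' + 1) → InFemtoWindow lam β' L' →
      luscherLambda β (L' + 1) = luscherLambda β' L' →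
      secondValue su2Rep L' β' ^ L' * topValue su2Rep (L' + 1) β ^ (L' + 1) ≤
        Real.exp (max C 0 * luscherLambda β (L' + 1) ^ 2 / (L' : ℝ)) * (secondValue su2Rep (L' + 1) β ^ (L' + 1) * topValue su2Rep L' β' ^ L') := by
    intro L' _ hL0 β β' hW hW' hm
    refine (HL L' hL0 β β' hW hW' hm).trans (mul_le_mul_of_nonneg_right ?_ ?_)
    · apply Real.exp_le_exp.mpr
      have hL'pos : (0 : ℝ) < L' := by exact_mod_cast Nat.pos_of_ne_zero (NeZero.ne L')
      exact div_le_div_of_nonneg_right (mul_le_mul_of_nonneg_right (le_max_left _ _) (sq_nonneg _)) hL'pos.le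
    · exact mul_nonneg (pow_nonneg (secondValue_su2Rep_nonneg (L' + 1) (zero_le_one.trans hW.1)) _) (pow_nonneg (topValue_su2Rep_pos L' β').le _)
  refine ⟨L0, fun L' _ L _ hL0 hlt hlt2 β β' hW hW' hm => ?_⟩
  have key := telescope hC hlam hle2 HL' L' hL0 β' hW' L hlt.le β hW hm
  refine key.trans (mul_le_mul_of_nonneg_right ?_ ?_)
  · apply Real.exp_le_exp.mpr
    rw [hm]
    have hL'pos : (0 : ℝ) < L' := by exact_mod_cast Nat.pos_of_ne_zero (NeZero.ne L')
    have hfrac : ((L : ℝ) - L') / (L' : ℝ) ≤ 1 := by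
      rw [div_le_one hL'pos]
      have : (L : ℝ) ≤ 2 * L' := by exact_mod_cast hlt2.le
      linarith
    have hnn : 0 ≤ max C 0 * luscherLambda β' L' ^ 2 := by positivity
    calc max C 0 * luscherLambda β' L' ^ 2 * ((L : ℝ) - L') / (L' : ℝ)
        = max C 0 * luscherLambda β' L' ^ 2 * (((L : ℝ) - L') / (L' : ℝ)) := by ring
      _ ≤ max C 0 * luscherLambda β' L' ^ 2 * 1 := mul_le_mul_of_nonneg_left hfrac hnn
      _ = max C 0 * luscherLambda β' L' ^ 2 := by ring
  · exact mul_nonneg (pow_nonneg (secondValue_su2Rep_nonneg L (zero_le_one.trans hW.1)) _) (pow_nonneg (topValue_su2Rep_pos L' β').le _)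

/-- ★★ ENGINE GLUE `PinnedUnitStepEx → UnitUpStep`: the min–max door of `upStepEv_of_pinnedUpStepEx` (p624204) at the unit pair
`(L', L'+1)` with the proportional budget `s = C·Λ²/L'`. [cite: Luscher1983, §3] [cite: Balaban1985Averaging, §1] -/
theorem unitUpStep_of_pinnedUnitStepEx (h : PinnedUnitStepEx) : UnitUpStep := by
  obtain ⟨C, lam0, hlam0, H⟩ := h
  refine ⟨C, lam0, hlam0, fun lam hlam hle => ?_⟩
  obtain ⟨L0, HL⟩ := H lam hlam hle
  refine ⟨L0, fun L' _ hL0 β β' hW hW' hm => ?_⟩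
  have hLL : L' ≤ L' + 1 := Nat.le_succ _
  have h2 : L' + 1 ≤ 2 * L' := by have := NeZero.one_le (n := L'); omega
  have hβ0 : 0 < β := zero_lt_one.trans_le hW.1
  have hβ' : 0 < β' := zero_lt_one.trans_le hW'.1
  have hL1 : 1 ≤ L' + 1 := NeZero.one_le
  set s : ℝ := C * luscherLambda β (L' + 1) ^ 2 / (L' : ℝ) with hsdef
  obtain ⟨Ω, θ, c, hΩ, hc, hcle, hΩ1, hΩeig, -, -, -⟩ := PhysL2.exists_groundState (L := L' + 1) β
  have hpos : ∀ U, 0 < Ω U := fun U => hc.trans_le (hcle U)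
  obtain ⟨Ω', θ', c', hΩ', hc', hcle', hn', heig', -, -, -⟩ := PhysL2.exists_groundState (L := L') β'
  have heigp : ∀ U, ∫ V, transferKernel su2Rep β U V * Ω V ∂(configMeasure SU2 (L' + 1)) = topValue su2Rep (L' + 1) β * Ω U :=
    fun U => by simpa [transferApply] using congrFun hΩeig U
  have heigp' : ∀ U', ∫ V', transferKernel su2Rep β' U' V' * Ω' V' ∂(configMeasure SU2 L') = topValue su2Rep L' β' * Ω' U' :=
    fun U => by simpa [transferApply] using congrFun heig' U
  obtain ⟨φ', hφ', horth, hn1, heigp1, HB⟩ := HL L' hL0 β β' hW hW' hm Ω hΩ hpos hΩ1 heigp Ω' hΩ' c' hc' hcle' hn' heigp'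
  simp only [] at HB
  obtain ⟨hvar, hineq⟩ := HB
  obtain ⟨hrm, ⟨Cg, hrb⟩, hrg, hrz, -⟩ := Dirichlet.ratio_multiplier hΩ' hφ' hc' hcle'
  have hratio : IsPhys (fun U' : GaugeConfig 3 L' SU2 => φ' U' / Ω' U') := ⟨hrm, ⟨Cg, hrb⟩, hrg, hrz⟩
  have havg := Thinning.isPhys_avg_thin_shift (G := SU2) hLL h2 hratio
  simp only [torusConfigShift_eq_pinnedInline, thin_eq_pinnedInline] at havg
  obtain ⟨Cf, hCf⟩ := havg.bounded
  have hw := IsPhys.mul_of_invariant hΩ havg.measurable hCf havg.gaugeInv havg.zeroFlux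
  have door : ∀ w : GaugeConfig 3 (L' + 1) SU2 → ℝ, IsPhys w → l2 w Ω ^ 2 < l2 w w →
      secondValue su2Rep L' β' ^ L' * topValue su2Rep (L' + 1) β ^ (L' + 1) * (l2 w w - l2 w Ω ^ 2) ≤
        Real.exp s * (topValue su2Rep L' β' ^ L' * (l2 w ((transferApply β)^[L' + 1] w) - topValue su2Rep (L' + 1) β ^ (L' + 1) * l2 w Ω ^ 2)) →
      secondValue su2Rep L' β' ^ L' * topValue su2Rep (L' + 1) β ^ (L' + 1) ≤
        Real.exp s * (secondValue su2Rep (L' + 1) β ^ (L' + 1) * topValue su2Rep L' β' ^ L') := by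
    intro w hw' hvar' hineq'
    obtain ⟨hv, hvorth, hnorm, htwo⟩ := UpStep.recentred_moments β hΩ hΩ1 hΩeig hw' (L' + 1)
    set v : GaugeConfig 3 (L' + 1) SU2 → ℝ := w + (-(l2 w Ω)) • Ω with hvdef
    have hvpos : 0 < l2 v v := by rw [hnorm]; linarith
    have hcmp : secondValue su2Rep L' β' ^ L' * topValue su2Rep (L' + 1) β ^ (L' + 1) * l2 v v ≤
        Real.exp s * (topValue su2Rep L' β' ^ L' * l2 v ((transferApply β)^[L' + 1] v)) := by
      rw [hnorm, htwo]; exact hineq'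
    have hvarb := UpStep.l2_iterate_le_pow_secondValue hβ0 hΩ hΩ1 hΩeig hv hvorth hL1
    have hb' : 0 ≤ topValue su2Rep L' β' ^ L' := pow_nonneg (topValue_su2Rep_pos L' β').le _
    have h1 : Real.exp s * (topValue su2Rep L' β' ^ L' * l2 v ((transferApply β)^[L' + 1] v)) ≤
        Real.exp s * (topValue su2Rep L' β' ^ L' * (secondValue su2Rep (L' + 1) β ^ (L' + 1) * l2 v v)) :=
      mul_le_mul_of_nonneg_left (mul_le_mul_of_nonneg_left hvarb hb') (Real.exp_pos _).le
    have h2' := hcmp.trans h1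
    have h3 : (secondValue su2Rep L' β' ^ L' * topValue su2Rep (L' + 1) β ^ (L' + 1)) * l2 v v ≤
        (Real.exp s * (secondValue su2Rep (L' + 1) β ^ (L' + 1) * topValue su2Rep L' β' ^ L')) * l2 v v := by
      calc (secondValue su2Rep L' β' ^ L' * topValue su2Rep (L' + 1) β ^ (L' + 1)) * l2 v v
          = secondValue su2Rep L' β' ^ L' * topValue su2Rep (L' + 1) β ^ (L' + 1) * l2 v v := by ring
        _ ≤ Real.exp s * (topValue su2Rep L' β' ^ L' * (secondValue su2Rep (L' + 1) β ^ (L' + 1) * l2 v v)) := h2'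
        _ = (Real.exp s * (secondValue su2Rep (L' + 1) β ^ (L' + 1) * topValue su2Rep L' β' ^ L')) * l2 v v := by ring
    exact le_of_mul_le_mul_right h3 hvpos
  exact door _ hw hvar hineq

/-- ★ The full chain of LINE g6-A: `PinnedUnitStepEx → UpStepEv` (items 27561 → 26796). [folklore] -/
theorem upStepEv_of_pinnedUnitStepEx (h : PinnedUnitStepEx) : UpStepEv :=
  upStepEv_of_unitUpStep (unitUpStep_of_pinnedUnitStepEx h)

/-- By-name bridge to the `FemtoCutoffLadder` copy of the shared crux `UpStepEv` (same body, shared item 26796). [folklore] -/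
theorem fcl_upStepEv_of_unitUpStep (h : UnitUpStep) : Summit.QuantumFields.YangMills.Theses.FemtoCutoffLadder.UpStepEv :=
  upStepEv_of_unitUpStep h

end Summit.QuantumFields.YangMills.Theorems.FlatTubeReduction.UnitLadder
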